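import Summits.SmoothPoincare4.SmoothPoincare4.Theorems.SymplecticOrigamiGromovRecognitionRelEndChartCoordinatesHolomorphic
import Summits.SmoothPoincare4.SmoothPoincare4.Theorems.SymplecticOrigamiGromovRecognitionRelEndWedgeCoordinateConsistent
import Mathlib.Geometry.Manifold.LocalDiffeomorph
import Mathlib.Analysis.Complex.Basic

/-!
# One holomorphic coordinate `T = p 2 + i p 3` near the sphere at infinity `H∞` of the wedge cap
(registered helper `helper_wedgeCoordinateH` of line `cross-cap-laurent`, crux
`GromovRecognitionRelEnd`, item stmt-SmoothPoincare4-11009)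

In the wedge cap `X` (almost complex structure `JX`) the sphere at infinity
`H∞ = ηH (ℂ × 0) ∪ {ηC 0}` is covered by the two cap charts
`ηH : D_H = {|(p 2, p 3)| < R₁⁻¹} → X` and `ηC : D_C = {|(p 0, p 1)| < R₁⁻¹, |(p 2, p 3)| < R₁⁻¹} → X`
(injective `C^∞` local diffeomorphisms intertwining `i ⊕ i` with `JX`).  This file produces ONE
function `T : X → ℂ` on the open neighbourhood `U_H = ηH '' D_H ∪ ηC '' D_C` of `H∞` which is
`C^∞`, `JX`-holomorphic (`dT (JX w) = i · dT w`), reads `T (ηH p) = p 2 + i p 3`,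
`T (ηC p) = p 2 + i p 3` in both charts, and whose zero set in `U_H` is exactly `H∞`.  Intersections
of `JX`-curves with `H∞` thereby become zeros of the holomorphic function `T ∘ u`.

Construction: `T_H := (p 2 + i p 3) ∘ ηH⁻¹` on `ηH '' D_H` and `T_C := (p 2 + i p 3) ∘ ηC⁻¹` on
`ηC '' D_C` are smooth and `JX`-holomorphic (`helper_chartCoordinatesHolomorphic`); they agree on
the overlap of the two (open) images (`helper_wedgeCoordinateConsistent`), so the function defined by
cases, `T y = T_H y` on `ηH '' D_H` and `T y = T_C y` otherwise, coincides with `T_H` near every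
point of `ηH '' D_H` and with `T_C` near every point of `ηC '' D_C`; smoothness and holomorphicity
are local (`ContMDiffAt.congr_of_eventuallyEq`, `Filter.EventuallyEq.mfderiv_eq`).  The zero set
is read off the chart values and the gluing clause `ηC = ηH ∘ inv₁` off the first axis.

Everything is proved; no definition, no named fact.

References: D. McDuff, D. Salamon, *Introduction to Symplectic Topology*, 3rd ed. (2017), §2.5,
§4.5 [McDuffSalamon2017]; M. Gromov, *Pseudo holomorphic curves in symplectic manifolds*,
Invent. Math. 82 (1985), 2.4.A₁′ [Gromov1985].
-/

-- the registered namespace `Summit.SmoothPoincare4.SmoothPoincare4.Theorems…` repeats a component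
set_option linter.dupNamespace false

open scoped Manifold ContDiff Topology
open Set Function Filter

namespace Summit.SmoothPoincare4.SmoothPoincare4.Theorems.GromovRecognitionRelEnd.CrossCapLaurent

namespace WedgeCoordinateH

/-- **Smoothness and `JX`-holomorphicity are local.**  If `T = f` on an open set `A` on which
`f : X → ℂ` is `C^∞` and `JX`-holomorphic (`df (JX w) = i · df w`), then at every point of `A` the
function `T` is `C^∞` and `dT (JX w) = i · dT w` (the differential only depends on the germ).
[folklore] -/
theorem contMDiffAt_and_hol_of_eqOn {X : Type*} [TopologicalSpace X]
    [ChartedSpace (EuclideanSpace ℝ (Fin 4)) X]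
    {JX : ∀ y : X, TangentSpace (𝓡 4) y →L[ℝ] TangentSpace (𝓡 4) y}
    {A : Set X} (hA : IsOpen A) {f T : X → ℂ} (hf : ContMDiffOn (𝓡 4) 𝓘(ℝ, ℂ) ∞ f A)
    (hhol : ∀ y ∈ A, ∀ w : TangentSpace (𝓡 4) y,
      (show ℂ from mfderiv (𝓡 4) 𝓘(ℝ, ℂ) f y (JX y w)) =
        Complex.I * (show ℂ from mfderiv (𝓡 4) 𝓘(ℝ, ℂ) f y w))
    (hTf : ∀ y ∈ A, T y = f y) {y : X} (hy : y ∈ A) :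
    ContMDiffAt (𝓡 4) 𝓘(ℝ, ℂ) ∞ T y ∧ ∀ w : TangentSpace (𝓡 4) y,
      (show ℂ from mfderiv (𝓡 4) 𝓘(ℝ, ℂ) T y (JX y w)) =
        Complex.I * (show ℂ from mfderiv (𝓡 4) 𝓘(ℝ, ℂ) T y w) := by
  have hE : T =ᶠ[𝓝 y] f := eventuallyEq_of_mem (hA.mem_nhds hy) hTf
  refine ⟨((hf y hy).contMDiffAt (hA.mem_nhds hy)).congr_of_eventuallyEq hE, fun w => ?_⟩
  have key := hhol y hy w
  dsimp only at key ⊢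
  rw [hE.mfderiv_eq]
  exact key

end WedgeCoordinateH

open WedgeCoordinateH in
/-- **Registered helper `helper_wedgeCoordinateH`** (line `cross-cap-laurent`, signature verbatim):
one holomorphic coordinate near `H∞`.  For the cap charts `ηH`, `ηC` of the wedge cap (injective
`C^∞` local diffeomorphisms on their polydiscs intertwining `i ⊕ i` with `JX`, glued to `ι ∘ χ`, to
`ηV` and to each other by the complex inversions of one factor, with the `V`-axis points and the
corner `ηC 0` outside `range ι` and the two axis images disjoint) there is `T : X → ℂ`, `C^∞` and
`JX`-holomorphic on the open set `U_H = ηH '' D_H ∪ ηC '' D_C`, with `T (ηH p) = p 2 + i p 3`,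
`T (ηC p) = p 2 + i p 3`, and `{y ∈ U_H | T y = 0} = ηH (ℂ × 0) ∪ {ηC 0} = H∞`.  See the file header
for the construction. [cite: McDuffSalamon2017, §2.5] -/
theorem helper_wedgeCoordinateH : ∀ (M : Type) (X : Type) [TopologicalSpace X] [T2Space X] [ChartedSpace (EuclideanSpace ℝ (Fin 4)) X] [IsManifold (𝓡 4) ∞ X] (JX : ∀ y : X, TangentSpace (𝓡 4) y →L[ℝ] TangentSpace (𝓡 4) y) (R₁ : ℝ) (χ : EuclideanSpace ℝ (Fin 4) → M) (ι : M → X) (ηH ηV ηC : EuclideanSpace ℝ (Fin 4) → X), 0 < R₁ → IsLocalDiffeomorphOn 𝓘(ℝ, EuclideanSpace ℝ (Fin 4)) (𝓡 4) ∞ ηH {p : EuclideanSpace ℝ (Fin 4) | p 2 ^ 2 + p 3 ^ 2 < R₁⁻¹ ^ 2} → Set.InjOn ηH {p : EuclideanSpace ℝ (Fin 4) | p 2 ^ 2 + p 3 ^ 2 < R₁⁻¹ ^ 2} → (∀ p : EuclideanSpace ℝ (Fin 4), p 2 ^ 2 + p 3 ^ 2 < R₁⁻¹ ^ 2 → ∀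 q : EuclideanSpace ℝ (Fin 4), JX (ηH p) (mfderiv 𝓘(ℝ, EuclideanSpace ℝ (Fin 4)) (𝓡 4) ηH p q) = mfderiv 𝓘(ℝ, EuclideanSpace ℝ (Fin 4)) (𝓡 4) ηH p (WithLp.toLp 2 ![-(q 1), q 0, -(q 3), q 2])) → IsLocalDiffeomorphOn 𝓘(ℝ, EuclideanSpace ℝ (Fin 4)) (𝓡 4) ∞ ηC {p : EuclideanSpace ℝ (Fin 4) | p 0 ^ 2 + p 1 ^ 2 < R₁⁻¹ ^ 2 ∧ p 2 ^ 2 + p 3 ^ 2 < R₁⁻¹ ^ 2} → Set.InjOn ηC {p : EuclideanSpace ℝ (Fin 4) | p 0 ^ 2 + p 1 ^ 2 < R₁⁻¹ ^ 2 ∧ p 2 ^ 2 + p 3 ^ 2 < R₁⁻¹ ^ 2} → (∀ p : EuclideanSpace ℝ (Fin 4), p 0 ^ 2 + p 1 ^ 2 < R₁⁻¹ ^ 2 → p 2 ^ 2 + p 3 ^ 2 < R₁⁻¹ ^ 2 → ∀ q : EuclideanSpace ℝ (Fin 4), JX (ηC p) (mfderiv 𝓘(ℝ, EuclideanSpace ℝ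 (Fin 4)) (𝓡 4) ηC p q) = mfderiv 𝓘(ℝ, EuclideanSpace ℝ (Fin 4)) (𝓡 4) ηC p (WithLp.toLp 2 ![-(q 1), q 0, -(q 3), q 2])) → (∀ p : EuclideanSpace ℝ (Fin 4), p 2 ^ 2 + p 3 ^ 2 < R₁⁻¹ ^ 2 → (p 2 ≠ 0 ∨ p 3 ≠ 0) → ηH p = ι (χ (WithLp.toLp 2 ![p 0, p 1, p 2 / (p 2 ^ 2 + p 3 ^ 2), -(p 3) / (p 2 ^ 2 + p 3 ^ 2)]))) → (∀ p : EuclideanSpace ℝ (Fin 4), p 0 = 0 → p 1 = 0 → ηV p ∉ Set.range ι) → (∀ p : EuclideanSpace ℝ (Fin 4), p 0 ^ 2 + p 1 ^ 2 < R₁⁻¹ ^ 2 → p 2 ^ 2 + p 3 ^ 2 < R₁⁻¹ ^ 2 → (p 2 ≠ 0 ∨ p 3 ≠ 0) → ηC p = ηV (WithLp.toLp 2 ![p 0, p 1, p 2 / (p 2 ^ 2 + p 3 ^ 2), -(p 3) / (p 2 ^ 2 + p 3 ^ 2)])) → (∀ p : EuclideanSpace ℝ (Fin 4), p 0 ^ 2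 + p 1 ^ 2 < R₁⁻¹ ^ 2 → p 2 ^ 2 + p 3 ^ 2 < R₁⁻¹ ^ 2 → (p 0 ≠ 0 ∨ p 1 ≠ 0) → ηC p = ηH (WithLp.toLp 2 ![p 0 / (p 0 ^ 2 + p 1 ^ 2), -(p 1) / (p 0 ^ 2 + p 1 ^ 2), p 2, p 3])) → ηC 0 ∉ Set.range ι → (∀ p q : EuclideanSpace ℝ (Fin 4), p 2 = 0 → p 3 = 0 → q 0 = 0 → q 1 = 0 → ηH p ≠ ηV q) → ∃ T : X → ℂ, IsOpen (ηH '' {p : EuclideanSpace ℝ (Fin 4) | p 2 ^ 2 + p 3 ^ 2 < R₁⁻¹ ^ 2} ∪ ηC '' {p : EuclideanSpace ℝ (Fin 4) | p 0 ^ 2 + p 1 ^ 2 < R₁⁻¹ ^ 2 ∧ p 2 ^ 2 + p 3 ^ 2 < R₁⁻¹ ^ 2}) ∧ ContMDiffOn (𝓡 4) 𝓘(ℝ, ℂ) ∞ T (ηH '' {p : EuclideanSpace ℝ (Fin 4) | p 2 ^ 2 + p 3 ^ 2 < R₁⁻¹ ^ 2} ∪ ηC '' {p : EuclideanSpace ℝ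 (Fin 4) | p 0 ^ 2 + p 1 ^ 2 < R₁⁻¹ ^ 2 ∧ p 2 ^ 2 + p 3 ^ 2 < R₁⁻¹ ^ 2}) ∧ (∀ y ∈ ηH '' {p : EuclideanSpace ℝ (Fin 4) | p 2 ^ 2 + p 3 ^ 2 < R₁⁻¹ ^ 2} ∪ ηC '' {p : EuclideanSpace ℝ (Fin 4) | p 0 ^ 2 + p 1 ^ 2 < R₁⁻¹ ^ 2 ∧ p 2 ^ 2 + p 3 ^ 2 < R₁⁻¹ ^ 2}, ∀ w : TangentSpace (𝓡 4) y, (show ℂ from mfderiv (𝓡 4) 𝓘(ℝ, ℂ) T y (JX y w)) = Complex.I * (show ℂ from mfderiv (𝓡 4) 𝓘(ℝ, ℂ) T y w)) ∧ (∀ p : EuclideanSpace ℝ (Fin 4), p 2 ^ 2 + p 3 ^ 2 < R₁⁻¹ ^ 2 → T (ηH p) = ⟨p 2, p 3⟩) ∧ (∀ p : EuclideanSpace ℝ (Fin 4), p 0 ^ 2 + p 1 ^ 2 < R₁⁻¹ ^ 2 → p 2 ^ 2 + p 3 ^ 2 < R₁⁻¹ ^ 2 → T (ηC p) = ⟨p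 2, p 3⟩) ∧ {y : X | y ∈ (ηH '' {p : EuclideanSpace ℝ (Fin 4) | p 2 ^ 2 + p 3 ^ 2 < R₁⁻¹ ^ 2} ∪ ηC '' {p : EuclideanSpace ℝ (Fin 4) | p 0 ^ 2 + p 1 ^ 2 < R₁⁻¹ ^ 2 ∧ p 2 ^ 2 + p 3 ^ 2 < R₁⁻¹ ^ 2}) ∧ T y = 0} = Set.range (fun z : ℂ => ηH (WithLp.toLp 2 ![z.re, z.im, 0, 0])) ∪ {ηC 0} := by
  intro M X _ _ _ _ JX R₁ χ ι ηH ηV ηC hR₁ hHloc hHinj hHhol hCloc hCinj hChol hHglue hVax hCV hCH hC0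
    hdisj
  classical
  -- the two coordinate polydiscs
  set DH : Set (EuclideanSpace ℝ (Fin 4)) :=
    {p : EuclideanSpace ℝ (Fin 4) | p 2 ^ 2 + p 3 ^ 2 < R₁⁻¹ ^ 2} with hDH
  set DC : Set (EuclideanSpace ℝ (Fin 4)) :=
    {p : EuclideanSpace ℝ (Fin 4) | p 0 ^ 2 + p 1 ^ 2 < R₁⁻¹ ^ 2 ∧ p 2 ^ 2 + p 3 ^ 2 < R₁⁻¹ ^ 2}
    with hDC
  have hR : (0 : ℝ) < R₁⁻¹ ^ 2 := by positivity
  have hc : ∀ i : Fin 4, Continuous fun p : EuclideanSpace ℝ (Fin 4) => p i := fun i =>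
    (continuous_apply i).comp (PiLp.continuous_ofLp 2 _)
  have hr1 : Continuous fun p : EuclideanSpace ℝ (Fin 4) => p 0 ^ 2 + p 1 ^ 2 :=
    ((hc 0).pow 2).add ((hc 1).pow 2)
  have hr2 : Continuous fun p : EuclideanSpace ℝ (Fin 4) => p 2 ^ 2 + p 3 ^ 2 :=
    ((hc 2).pow 2).add ((hc 3).pow 2)
  have hDHo : IsOpen DH := isOpen_lt hr2 continuous_const
  have hDCo : IsOpen DC := (isOpen_lt hr1 continuous_const).and (isOpen_lt hr2 continuous_const)
  -- the second complex coordinate read through `ηH` and through `ηC`: smooth, `JX`-holomorphic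
  obtain ⟨hUHo, -, hTH, -, hTHhol⟩ := helper_chartCoordinatesHolomorphic X JX ηH DH hDHo hHloc hHinj
    (fun p hp q => hHhol p hp q)
  obtain ⟨hUCo, -, hTC, -, hTChol⟩ := helper_chartCoordinatesHolomorphic X JX ηC DC hDCo hCloc hCinj
    (fun p hp q => hChol p hp.1 hp.2 q)
  set TH : X → ℂ :=
    (fun y => (⟨(Function.invFunOn ηH DH y) 2, (Function.invFunOn ηH DH y) 3⟩ : ℂ)) with hTHdef
  set TC : X → ℂ :=
    (fun y => (⟨(Function.invFunOn ηC DC y) 2, (Function.invFunOn ηC DC y) 3⟩ : ℂ)) with hTCdef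
  have hTHval : ∀ p ∈ DH, TH (ηH p) = ⟨p 2, p 3⟩ := fun p hp => by
    simp only [hTHdef]
    rw [hHinj.leftInvOn_invFunOn hp]
  have hTCval : ∀ p ∈ DC, TC (ηC p) = ⟨p 2, p 3⟩ := fun p hp => by
    simp only [hTCdef]
    rw [hCinj.leftInvOn_invFunOn hp]
  -- the two readings agree on the overlap of the chart images
  have hcons : ∀ y ∈ ηH '' DH, y ∈ ηC '' DC → TH y = TC y := by
    rintro _ ⟨p, hp, rfl⟩ ⟨p', hp', he⟩
    obtain ⟨h2, h3⟩ := helper_wedgeCoordinateConsistent M X R₁ χ ι ηH ηV ηC hHinj hHglue hVax hCV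
      hCH hC0 hdisj p p' hp hp'.1 hp'.2 he.symm
    rw [hTHval p hp, ← he, hTCval p' hp', h2, h3]
  -- the glued coordinate `T`
  obtain ⟨T, hT⟩ : ∃ T : X → ℂ, ∀ y, T y = if y ∈ ηH '' DH then TH y else TC y :=
    ⟨fun y => if y ∈ ηH '' DH then TH y else TC y, fun _ => rfl⟩
  have hT_H : ∀ y ∈ ηH '' DH, T y = TH y := fun y hy => by rw [hT, if_pos hy]
  have hT_C : ∀ y ∈ ηC '' DC, T y = TC y := fun y hy => by
    by_cases h : y ∈ ηH '' DH
    · rw [hT_H y h]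
      exact hcons y h hy
    · rw [hT, if_neg h]
  have hvalH : ∀ p ∈ DH, T (ηH p) = ⟨p 2, p 3⟩ := fun p hp => by
    rw [hT_H _ ⟨p, hp, rfl⟩, hTHval p hp]
  have hvalC : ∀ p ∈ DC, T (ηC p) = ⟨p 2, p 3⟩ := fun p hp => by
    rw [hT_C _ ⟨p, hp, rfl⟩, hTCval p hp]
  refine ⟨T, hUHo.union hUCo, ?_, ?_, fun p hp => hvalH p hp,
    fun p hp₁ hp₂ => hvalC p ⟨hp₁, hp₂⟩, ?_⟩
  · -- smoothness is local: `T = T_H` near `ηH '' D_H`, `T = T_C` near `ηC '' D_C` (both open)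
    rintro y (hy | hy)
    · exact (contMDiffAt_and_hol_of_eqOn hUHo hTH hTHhol hT_H hy).1.contMDiffWithinAt
    · exact (contMDiffAt_and_hol_of_eqOn hUCo hTC hTChol hT_C hy).1.contMDiffWithinAt
  · -- and so is holomorphicity
    rintro y (hy | hy) w
    · exact (contMDiffAt_and_hol_of_eqOn hUHo hTH hTHhol hT_H hy).2 w
    · exact (contMDiffAt_and_hol_of_eqOn hUCo hTC hTChol hT_C hy).2 w
  · -- the zero set of `T` in `U_H` is `H∞ = ηH (ℂ × 0) ∪ {ηC 0}`
    ext y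
    simp only [mem_setOf_eq, mem_union, mem_range, mem_singleton_iff]
    constructor
    · rintro ⟨hy | hy, hT0⟩
      · -- `y = ηH p` with `p 2 = p 3 = 0`: a point of the affine part `ηH (ℂ × 0)`
        obtain ⟨p, hp, rfl⟩ := hy
        rw [hvalH p hp] at hT0
        have h2 : p 2 = 0 := by simpa using congrArg Complex.re hT0
        have h3 : p 3 = 0 := by simpa using congrArg Complex.im hT0
        refine Or.inl ⟨⟨p 0, p 1⟩, ?_⟩
        show ηH _ = ηH p
        congr 1
        ext i
        fin_cases i <;> simp [h2, h3]
      · -- `y = ηC p` with `p 2 = p 3 = 0`: off the first axis `ηC p = ηH (1 / z₁, 0)`, else `p = 0`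
        obtain ⟨p, hp, rfl⟩ := hy
        rw [hvalC p hp] at hT0
        have h2 : p 2 = 0 := by simpa using congrArg Complex.re hT0
        have h3 : p 3 = 0 := by simpa using congrArg Complex.im hT0
        by_cases h01 : p 0 ≠ 0 ∨ p 1 ≠ 0
        · refine Or.inl ⟨⟨p 0 / (p 0 ^ 2 + p 1 ^ 2), -(p 1) / (p 0 ^ 2 + p 1 ^ 2)⟩, ?_⟩
          show ηH _ = ηC p
          rw [hCH p hp.1 hp.2 h01]
          congr 1
          ext i
          fin_cases i <;> simp [h2, h3]
        · simp only [not_or, not_not] at h01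
          have hp0 : p = 0 := by
            ext i
            fin_cases i <;> simp [h01.1, h01.2, h2, h3]
          exact Or.inr (congrArg ηC hp0)
    · rintro (⟨z, rfl⟩ | rfl)
      · -- the affine part: `ηH (z, 0) ∈ ηH '' D_H` and `T = 0 + i 0` there
        have hmem : (WithLp.toLp 2 ![z.re, z.im, 0, 0] : EuclideanSpace ℝ (Fin 4)) ∈ DH := by
          rw [hDH]
          simpa using hR
        exact ⟨Or.inl ⟨_, hmem, rfl⟩, by rw [hvalH _ hmem]; simp [Complex.ext_iff]⟩
      · -- the point at infinity `ηC 0`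
        have hmem : (0 : EuclideanSpace ℝ (Fin 4)) ∈ DC := by
          rw [hDC]
          simpa using hR
        exact ⟨Or.inr ⟨0, hmem, rfl⟩, by rw [hvalC 0 hmem]; simp [Complex.ext_iff]⟩

end Summit.SmoothPoincare4.SmoothPoincare4.Theorems.GromovRecognitionRelEnd.CrossCapLaurent
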